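import Mathlib
import Literature.Computability.AlgebraicComplexity.LinSubst

/-!
# Triangular linear substitutions on monomials: weight dominance, diagonal coefficients, supports

Crux `ValuativeGCT.ValuativeFlip` (stmt-ValiantsHypothesis-12624), wall-breaker axis
"explicit padded-permanent highest-weight vectors" (k5 gen 1): toolkit, part 1 of 3, for the
explicit highest-weight vectors `catMinor` of `…CatalecticantHWV.lean` (corner minors of
catalecticants).  Everything here is about the substitution `M · X^d = ∏_l (Σ_j M_{jl} X_j)^{d_l}`
(`linSubst M`, `X_l ↦ Σ_j M_{jl} X_j`) of a MONOMIAL over a commutative ring: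

* weight dominance (`wdom_linSubst_monomial`): if `M_{jl} ≠ 0 ⇒ w l ≤ w j` for a weight
  `w : σ → ℕ`, every monomial of `M · X^d` has `w`-weight `≥ weight w d`
  (`coeff_linSubst_monomial_eq_zero_of_weight_lt`);
* the diagonal coefficient (`coeff_self_linSubst_monomial`): if every off-diagonal nonzero entry is
  separated by an admissible weight, `coeff_{X^d} (M · X^d) = ∏_l M_{ll}^{d_l}`; for an upper
  triangular `B` (`B.BlockTriangular id`, the Borel of `GLHighestWeight.IsUpperTriangular`) every
  antitone weight is admissible, for `Bᵀ` every monotone one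
  (`coeff_self_linSubst_monomial_of_blockTriangular`, `…_transpose_…`);
* supports: under `Bᵀ` mass only moves to GREATER variables, under `B` only to smaller ones, so
  final segments `{i₀ ≤ ·}` of variables are preserved in the relevant direction
  (`support_ge_of_coeff_linSubst_transpose_ne_zero`, `support_ge_of_coeff_linSubst_ne_zero`).
Part 2 (`…Catalecticant.lean`) adds the lexicographic triangularity and the catalecticant blocks,
part 3 the highest-weight vectors.  [Fulton–Harris §15.5 (weights of `Sym`); folklore]
-/

set_option linter.dupNamespace false

namespace Summit.ValiantsHypothesis.ValiantsHypothesis.Theorems.ValuativeFlip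

open MvPolynomial
open scoped BigOperators Matrix
open Literature.Computability.AlgebraicComplexity

noncomputable section

section WDom

variable {σ : Type*} {R : Type*} [CommRing R]

/-- Weight dominance is closed under addition: if every monomial of `p` and of `q` has `w`-weight
at least `P`, so does every monomial of `p + q`. [folklore] -/
theorem wdom_add {w : σ → ℕ} {P : ℕ} {p q : MvPolynomial σ R}
    (hp : ∀ d ∈ p.support, P ≤ Finsupp.weight w d) (hq : ∀ d ∈ q.support, P ≤ Finsupp.weight w d) :
    ∀ d ∈ (p + q).support, P ≤ Finsupp.weight w d := by
  classical
  intro d hd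
  rcases Finset.mem_union.mp (support_add hd) with h | h
  · exact hp d h
  · exact hq d h

/-- Weight dominance is closed under finite sums. [folklore] -/
theorem wdom_sum {ι : Type*} {w : σ → ℕ} {P : ℕ} (s : Finset ι) {f : ι → MvPolynomial σ R}
    (h : ∀ i ∈ s, ∀ d ∈ (f i).support, P ≤ Finsupp.weight w d) :
    ∀ d ∈ (∑ i ∈ s, f i).support, P ≤ Finsupp.weight w d := by
  classical
  induction s using Finset.induction_on with
  | empty => intro d hd; simp at hd
  | insert a s ha ih =>
    rw [Finset.sum_insert ha]
    exact wdom_add (h a (Finset.mem_insert_self a s)) (ih fun i hi => h i (Finset.mem_insert_of_mem hi))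

/-- Weight dominance is closed under scalars. [folklore] -/
theorem wdom_smul {w : σ → ℕ} {P : ℕ} {p : MvPolynomial σ R}
    (hp : ∀ d ∈ p.support, P ≤ Finsupp.weight w d) (c : R) :
    ∀ d ∈ (c • p).support, P ≤ Finsupp.weight w d :=
  fun d hd => hp d (support_smul hd)

/-- Weight bounds add under multiplication. [folklore] -/
theorem wdom_mul {w : σ → ℕ} {P Q : ℕ} {p q : MvPolynomial σ R}
    (hp : ∀ d ∈ p.support, P ≤ Finsupp.weight w d) (hq : ∀ d ∈ q.support, Q ≤ Finsupp.weight w d) :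
    ∀ d ∈ (p * q).support, P + Q ≤ Finsupp.weight w d := by
  classical
  intro d hd
  obtain ⟨a, ha, b, hb, rfl⟩ := Finset.mem_add.mp (support_mul p q hd)
  rw [map_add]
  exact Nat.add_le_add (hp a ha) (hq b hb)

/-- Weight bounds scale under powers. [folklore] -/
theorem wdom_pow {w : σ → ℕ} {P : ℕ} {p : MvPolynomial σ R}
    (hp : ∀ d ∈ p.support, P ≤ Finsupp.weight w d) (n : ℕ) :
    ∀ d ∈ (p ^ n).support, n * P ≤ Finsupp.weight w d := by
  induction n with
  | zero => intro d _; simp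
  | succ n ih =>
    rw [pow_succ, Nat.succ_mul]
    exact wdom_mul ih hp

/-- A variable of weight `≥ P` is dominated by `P`. [folklore] -/
theorem wdom_X_of_le {w : σ → ℕ} {P : ℕ} (j : σ) (h : P ≤ w j) :
    ∀ d ∈ (X j : MvPolynomial σ R).support, P ≤ Finsupp.weight w d := by
  classical
  intro d hd
  have hd' : d ∈ ({Finsupp.single j 1} : Finset (σ →₀ ℕ)) := support_monomial_subset hd
  rw [Finset.mem_singleton] at hd'
  subst hd'
  rw [Finsupp.weight_single, one_smul]
  exact h

/-- Induction on finitely supported functions one unit at a time. [folklore] -/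
theorem finsupp_induction_add_single_one {p : (σ →₀ ℕ) → Prop} (h0 : p 0)
    (hs : ∀ (f : σ →₀ ℕ) (a : σ), p f → p (f + Finsupp.single a 1)) (d : σ →₀ ℕ) : p d := by
  induction d using Finsupp.induction with
  | zero => exact h0
  | single_add a b f ha hb ih =>
    clear ha hb
    induction b with
    | zero => simpa using ih
    | succ n ihn =>
      have : Finsupp.single a (n + 1) + f = (Finsupp.single a n + f) + Finsupp.single a 1 := by
        rw [Finsupp.single_add]; abel
      rw [this]
      exact hs _ a ihn

variable [Fintype σ]

/-- **Weight dominance of a linear substitution.** If `M j l ≠ 0` only when `w l ≤ w j`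
(the variable `X_l` is sent to variables of weight at least `w l`), then every monomial of
`M · X^d` has `w`-weight at least `weight w d`. [folklore] -/
theorem wdom_linSubst_monomial (M : Matrix σ σ R) (w : σ → ℕ)
    (hM : ∀ j l, M j l ≠ 0 → w l ≤ w j) (d : σ →₀ ℕ) :
    ∀ e ∈ (linSubst σ R M (monomial d 1)).support, Finsupp.weight w d ≤ Finsupp.weight w e := by
  classical
  have hX : ∀ l, ∀ e ∈ (linSubst σ R M (X l)).support, w l ≤ Finsupp.weight w e := by
    intro l
    rw [linSubst_X]
    refine wdom_sum _ fun j _ => ?_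
    by_cases h : M j l = 0
    · rw [h, zero_smul]; intro e he; simp at he
    · exact wdom_smul (wdom_X_of_le j (hM j l h)) _
  induction d using Finsupp.induction with
  | zero =>
    rw [map_zero, monomial_zero', linSubst_C]
    intro e _; exact Nat.zero_le _
  | single_add a b f _ _ ih =>
    rw [monomial_single_add, map_mul, map_pow, map_add, Finsupp.weight_single, smul_eq_mul]
    exact wdom_mul (wdom_pow (hX a) b) ih

/-- Coefficients of weight below `weight w d` vanish in `M · X^d`. [folklore] -/
theorem coeff_linSubst_monomial_eq_zero_of_weight_lt (M : Matrix σ σ R) (w : σ → ℕ)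
    (hM : ∀ j l, M j l ≠ 0 → w l ≤ w j) {d e : σ →₀ ℕ}
    (he : Finsupp.weight w e < Finsupp.weight w d) :
    coeff e (linSubst σ R M (monomial d 1)) = 0 := by
  by_contra h
  exact absurd (wdom_linSubst_monomial M w hM d e (mem_support_iff.mpr h)) (not_le.mpr he)


/-- **Diagonal coefficient of a triangular substitution.** If for every off-diagonal nonzero entry
`M j l ≠ 0` (`j ≠ l`) some admissible weight separates `l` from `j`, then the coefficient of `X^d`
itself in `M · X^d` is `∏_l M_{ll}^{d_l}`. [folklore] -/
theorem coeff_self_linSubst_monomial (M : Matrix σ σ R)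
    (hsep : ∀ j l, M j l ≠ 0 → j ≠ l →
      ∃ w : σ → ℕ, (∀ j' l', M j' l' ≠ 0 → w l' ≤ w j') ∧ w l < w j)
    (d : σ →₀ ℕ) :
    coeff d (linSubst σ R M (monomial d 1)) = d.prod fun l e => M l l ^ e := by
  classical
  induction d using finsupp_induction_add_single_one with
  | h0 =>
    rw [monomial_zero', linSubst_C, coeff_C, if_pos rfl, Finsupp.prod_zero_index]
  | hs f a ih =>
    have hmon : (monomial (f + Finsupp.single a 1) (1 : R)) = monomial f 1 * X a := by
      rw [X, monomial_mul, mul_one]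
    rw [hmon, map_mul, linSubst_X, Finset.mul_sum, coeff_sum]
    have hterm : ∀ j, coeff (f + Finsupp.single a 1)
        (linSubst σ R M (monomial f 1) * (M j a • X j)) =
        if j = a then M a a * coeff f (linSubst σ R M (monomial f 1)) else 0 := by
      intro j
      rw [mul_smul_comm, coeff_smul, coeff_mul_X', smul_eq_mul]
      by_cases hja : j = a
      · subst hja
        simp
      · rw [if_neg hja]
        by_cases hM0 : M j a = 0
        · rw [hM0, zero_mul]
        split_ifs with hmem
        · obtain ⟨w, hw, hlt⟩ := hsep j a hM0 hja
          rw [coeff_linSubst_monomial_eq_zero_of_weight_lt M w hw, mul_zero]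
          have hj1 : Finsupp.single j 1 ≤ f := by
            rw [Finsupp.single_le_iff]
            have : (f + Finsupp.single a 1 : σ →₀ ℕ) j ≠ 0 := Finsupp.mem_support_iff.mp hmem
            rw [Finsupp.add_apply, Finsupp.single_apply, if_neg (Ne.symm hja), add_zero] at this
            exact Nat.one_le_iff_ne_zero.mpr this
          have hf : f = (f - Finsupp.single j 1) + Finsupp.single j 1 :=
            (tsub_add_cancel_of_le hj1).symm
          have hg : f + Finsupp.single a 1 - Finsupp.single j 1 =
              (f - Finsupp.single j 1) + Finsupp.single a 1 := by
            conv_lhs => rw [hf]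
            rw [add_right_comm, add_tsub_cancel_right]
          rw [hg]
          conv_rhs => rw [hf]
          rw [map_add, map_add, Finsupp.weight_single, Finsupp.weight_single, one_smul, one_smul]
          exact Nat.add_lt_add_left hlt _
        · rw [mul_zero]
    simp only [hterm, Finset.sum_ite_eq', Finset.mem_univ, if_true, ih]
    rw [Finsupp.prod_add_index', Finsupp.prod_single_index, pow_one, mul_comm]
    · simp
    · intro i; simp
    · intro i m n; rw [pow_add]


end WDom

/-! ### Upper triangular substitutions: diagonal coefficients and supports -/

section Triangular

variable {σ : Type*} {R : Type*} [CommRing R]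

/-- Weights as `Fintype` sums. [folklore] -/
theorem weight_eq_sum [Fintype σ] (w : σ → ℕ) (f : σ →₀ ℕ) : Finsupp.weight w f = ∑ i, f i * w i := by
  rw [Finsupp.weight_apply, Finsupp.sum_fintype]
  · rfl
  · intro i; simp

/-- The degree as a `Fintype` sum. [folklore] -/
theorem degree_eq_sum [Fintype σ] (f : σ →₀ ℕ) : f.degree = ∑ i, f i := by
  have h : f.degree = Finsupp.weight (fun _ => 1) f := DFunLike.congr_fun Finsupp.degree_eq_weight_one f
  rw [h, weight_eq_sum]
  simp

/-- For an upper triangular `B` (`B j l = 0` for `l < j`), every ANTITONE weight is admissible: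
`B j l ≠ 0 → w l ≤ w j`. [folklore] -/
theorem antitone_admissible [LinearOrder σ] {B : Matrix σ σ R} (hB : B.BlockTriangular id) {w : σ → ℕ}
    (hw : Antitone w) : ∀ j l, B j l ≠ 0 → w l ≤ w j := by
  intro j l h
  have hjl : j ≤ l := le_of_not_gt fun hlt => h (hB hlt)
  exact hw hjl

/-- For the transpose of an upper triangular `B`, every MONOTONE weight is admissible. [folklore] -/
theorem monotone_admissible_transpose [LinearOrder σ] {B : Matrix σ σ R} (hB : B.BlockTriangular id) {w : σ → ℕ}
    (hw : Monotone w) : ∀ j l, Bᵀ j l ≠ 0 → w l ≤ w j := by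
  intro j l h
  rw [Matrix.transpose_apply] at h
  have hlj : l ≤ j := le_of_not_gt fun hlt => h (hB hlt)
  exact hw hlj

/-- The indicator weight of a lower set `{· ≤ i}` is antitone. [folklore] -/
theorem antitone_indicator_le [LinearOrder σ] (i : σ) :
    Antitone (fun x : σ => if x ≤ i then (1 : ℕ) else 0) := by
  intro x y hxy
  dsimp only
  by_cases hy : y ≤ i
  · rw [if_pos hy, if_pos (hxy.trans hy)]
  · rw [if_neg hy]; exact Nat.zero_le _

/-- The indicator weight of a lower set `{· < i}` is antitone. [folklore] -/
theorem antitone_indicator_lt [LinearOrder σ] (i : σ) :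
    Antitone (fun x : σ => if x < i then (1 : ℕ) else 0) := by
  intro x y hxy
  dsimp only
  by_cases hy : y < i
  · rw [if_pos hy, if_pos (hxy.trans_lt hy)]
  · rw [if_neg hy]; exact Nat.zero_le _

/-- The indicator weight of an upper set `{i ≤ ·}` is monotone. [folklore] -/
theorem monotone_indicator_ge [LinearOrder σ] (i : σ) :
    Monotone (fun x : σ => if i ≤ x then (1 : ℕ) else 0) := by
  intro x y hxy
  dsimp only
  by_cases hx : i ≤ x
  · rw [if_pos hx, if_pos (hx.trans hxy)]
  · rw [if_neg hx]; exact Nat.zero_le _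

/-- The indicator weight of an upper set `{i < ·}` is monotone. [folklore] -/
theorem monotone_indicator_gt [LinearOrder σ] (i : σ) :
    Monotone (fun x : σ => if i < x then (1 : ℕ) else 0) := by
  intro x y hxy
  dsimp only
  by_cases hx : i < x
  · rw [if_pos hx, if_pos (hx.trans_le hxy)]
  · rw [if_neg hx]; exact Nat.zero_le _

/-- **Diagonal coefficient, upper triangular case**: the coefficient of `X^d` in `B · X^d` is
`∏_l B_{ll}^{d_l}`. [folklore] -/
theorem coeff_self_linSubst_monomial_of_blockTriangular [Fintype σ] [LinearOrder σ] {B : Matrix σ σ R}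
    (hB : B.BlockTriangular id) (d : σ →₀ ℕ) :
    coeff d (linSubst σ R B (monomial d 1)) = d.prod fun l e => B l l ^ e := by
  refine coeff_self_linSubst_monomial B (fun j l h hjl => ?_) d
  have hjl' : j < l := lt_of_le_of_ne (le_of_not_gt fun hlt => h (hB hlt)) hjl
  refine ⟨fun x => if x ≤ j then 1 else 0, antitone_admissible hB (antitone_indicator_le j), ?_⟩
  simp [not_le.mpr hjl']

/-- **Diagonal coefficient, transposed case**: the coefficient of `X^d` in `Bᵀ · X^d` is
`∏_l B_{ll}^{d_l}` as well. [folklore] -/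
theorem coeff_self_linSubst_transpose_monomial_of_blockTriangular [Fintype σ] [LinearOrder σ] {B : Matrix σ σ R}
    (hB : B.BlockTriangular id) (d : σ →₀ ℕ) :
    coeff d (linSubst σ R Bᵀ (monomial d 1)) = d.prod fun l e => B l l ^ e := by
  have h := coeff_self_linSubst_monomial Bᵀ (fun j l h hjl => ?_) d
  · simpa only [Matrix.transpose_apply] using h
  have h' : B l j ≠ 0 := by simpa [Matrix.transpose_apply] using h
  have hlj : l < j := lt_of_le_of_ne (le_of_not_gt fun hlt => h' (hB hlt)) (Ne.symm hjl)
  refine ⟨fun x => if j ≤ x then 1 else 0, monotone_admissible_transpose hB (monotone_indicator_ge j), ?_⟩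
  simp [not_le.mpr hlj]

/-- **Support closure, transposed case**: if `X^d` is supported on the upper set `{i₀ ≤ ·}` and
`X^e` occurs in `Bᵀ · X^d`, then `X^e` is supported on `{i₀ ≤ ·}` (mass only moves up).
[folklore] -/
theorem support_ge_of_coeff_linSubst_transpose_ne_zero [Fintype σ] [LinearOrder σ] {B : Matrix σ σ R}
    (hB : B.BlockTriangular id) {d e : σ →₀ ℕ} (i₀ : σ) (hd : ∀ i ∈ d.support, i₀ ≤ i)
    (h : coeff e (linSubst σ R Bᵀ (monomial d 1)) ≠ 0) : ∀ i ∈ e.support, i₀ ≤ i := by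
  classical
  set w : σ → ℕ := fun x => if i₀ ≤ x then 1 else 0 with hw
  -- degrees agree
  have hdeg : e.degree = d.degree := by
    by_contra hne
    exact h ((linSubst_isHomogeneous Bᵀ (isHomogeneous_monomial (1 : R) rfl)).coeff_eq_zero hne)
  -- weight of d is its degree
  have hwd : Finsupp.weight w d = d.degree := by
    rw [weight_eq_sum, degree_eq_sum]
    refine Finset.sum_congr rfl fun i _ => ?_
    by_cases hi : i ∈ d.support
    · simp [hw, hd i hi]
    · simp [Finsupp.notMem_support_iff.mp hi]
  -- weight of e is at least that of d
  have hwe : Finsupp.weight w d ≤ Finsupp.weight w e := by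
    by_contra hlt
    exact h (coeff_linSubst_monomial_eq_zero_of_weight_lt Bᵀ w
      (monotone_admissible_transpose hB (monotone_indicator_ge i₀)) (not_le.mp hlt))
  -- hence every index of e is ≥ i₀
  intro i hi
  by_contra hi₀
  have hlt : Finsupp.weight w e < e.degree := by
    rw [weight_eq_sum, degree_eq_sum]
    refine Finset.sum_lt_sum (fun j _ => ?_) ⟨i, Finset.mem_univ i, ?_⟩
    · by_cases hj : i₀ ≤ j <;> simp [hw, hj]
    · simp only [hw, if_neg hi₀, mul_zero]
      exact Nat.pos_of_ne_zero (Finsupp.mem_support_iff.mp hi)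
  omega

/-- **Support closure, upper triangular case**: if `X^e` is supported on the upper set `{i₀ ≤ ·}`
and `X^e` occurs in `B · X^d`, then `X^d` is supported on `{i₀ ≤ ·}` (mass only moves down).
[folklore] -/
theorem support_ge_of_coeff_linSubst_ne_zero [Fintype σ] [LinearOrder σ] {B : Matrix σ σ R}
    (hB : B.BlockTriangular id) {d e : σ →₀ ℕ} (i₀ : σ) (he : ∀ i ∈ e.support, i₀ ≤ i)
    (h : coeff e (linSubst σ R B (monomial d 1)) ≠ 0) : ∀ i ∈ d.support, i₀ ≤ i := by
  classical
  set w : σ → ℕ := fun x => if x < i₀ then 1 else 0 with hw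
  have hwe : Finsupp.weight w e = 0 := by
    rw [weight_eq_sum]
    refine Finset.sum_eq_zero fun i _ => ?_
    by_cases hi : i ∈ e.support
    · simp [hw, not_lt.mpr (he i hi)]
    · simp [Finsupp.notMem_support_iff.mp hi]
  have hwd : Finsupp.weight w d ≤ Finsupp.weight w e := by
    by_contra hlt
    exact h (coeff_linSubst_monomial_eq_zero_of_weight_lt B w
      (antitone_admissible hB (antitone_indicator_lt i₀)) (not_le.mp hlt))
  rw [hwe, Nat.le_zero, weight_eq_sum, Finset.sum_eq_zero_iff] at hwd
  intro i hi
  by_contra hi₀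
  have := hwd i (Finset.mem_univ i)
  simp only [hw, if_pos (not_le.mp hi₀), mul_one] at this
  exact (Finsupp.mem_support_iff.mp hi) this

end Triangular

end

end Summit.ValiantsHypothesis.ValiantsHypothesis.Theorems.ValuativeFlip
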